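import Literature.NumberTheory.NumberFields.EquivariantSUnitRank
import Literature.RepresentationTheory.FiniteGroups.StableLatticeReductionHom
import Mathlib.RingTheory.IntegralDomain
import Mathlib.RingTheory.Localization.BaseChange
import Mathlib.Algebra.MonoidAlgebra.MapDomain
import Mathlib.Algebra.MonoidAlgebra.Module
import HarnessLib

/-!
# The equivariant `S`-unit theorem mod `p`:
# `[𝒪_{E,S}^×/p] + [𝔽_p] = [𝒪_{E,S}^×[p]] + [𝔽_p[S_E ⊔ S_∞(E)]]` for every invariant additive on
# finite `p`-torsion `ℤ[Gal(E/F)]`-modules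

Topic `NumberTheory/NumberFields`; namespace `Literature.NumberTheory.NumberFields.EquivariantSUnit`.
THEOREMS ONLY (no definition, no named fact, no `sorry`, no instance).  Sequel of `EquivariantSUnitRank`
(Herbrand: `(ℚ ⊗ 𝒪_{E,S}^×) ⊕ 𝟙 ≅ ℚ[S_E ⊔ S_∞(E)]`) and of `StableLatticeReductionHom` (Serre §15.2
Thm. 32 / Milne I Lemma 2.12 along a rational comparison).  Brick «B7c» of lane «TATE-EPC-TC», cell
`bsd-eis` (stmt-BirchSwinnertonDyer-19032): the input "`[E_{L,S}/p] = [μ_p] + Σ_v [𝔽_p[G/D_v]] − [𝔽_p]`"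
of Tate's global Euler–Poincaré characteristic at a totally complex field (Milne I §5).

Setting: number fields `K ⊆ F ⊆ E`, `E/F` Galois with group `G = E ≃ₐ[F] E`, `S` a finite set of
finite places of `K`, `p` a prime; `Λ = 𝒪_{E,S}^×` as the `ℤ[G]`-module `sUnitsRepρ K S F E` (on
`Additive (sUnits K S E)`), `X = placesAbove K S F E ⊕ InfinitePlace E` and `ℤ[X]`, `ℚ[X]` the
permutation modules (Mathlib `Representation.ofMulAction`, on `MonoidAlgebra _ X`); `ψ` any function
on `ℤ`-linear `G`-representations additive on short exact sequences with finite middle term killed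
by `p` (the binder pair of `StableLatticeReductionInvariantInt`, verbatim).

* §1 `ℤ[X] ↪ ℚ[X]` (injective, equivariant, spanning) and the rational structure
  `Λ × ℤ → (ℚ ⊗ Λ) × ℚ ≅ ℚ[X]` (kernel = torsion = roots of unity: finite CYCLIC inside `Eˣ`);
* §2 **`additive_sUnits_reduction`**: `ψ(Λ/pΛ) + ψ(ℤ/p) = ψ(Λ[p]) + ψ(ℤ[X]/pℤ[X])`.

References: [CasselsFrohlichANT1967] Ch. VII (Tate) §8.3; [NeukirchSchmidtWingberg2008] (8.7.2),
VIII §3; [MilneADT2006] I Lemma 2.12, §5; [SerreLinearRepresentations1977] §15.2 Thm. 32.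
-/

noncomputable section

open NumberField IsDedekindDomain Module Representation MulAction Function Submodule
open Literature.NumberTheory.GaloisRepresentations.SUnits
open Literature.RepresentationTheory Literature.RepresentationTheory.FiniteGroups.StableLatticeReduction
open Literature.RepresentationTheory.IntertwiningBaseChange (repBaseChange repBaseChange_apply)
open scoped Pointwise TensorProduct

namespace Literature.NumberTheory.NumberFields

namespace EquivariantSUnit

universe w

/-! ## §1 Integral structures: `ℤ[X] ⊂ ℚ[X]` and Herbrand's rational structure -/

section Generic

variable {G : Type w} [Group G] {X : Type} [MulAction G X]

/-- `ℤ[X] → ℚ[X]` (coefficient extension) is injective.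
[cite: SerreLinearRepresentations1977, §15.1 (lattices)] -/
theorem intCastMonoidAlgebra_injective :
    Injective (AddMonoidHom.mk' (MonoidAlgebra.map (M := X) (Int.castAddHom ℚ))
      (MonoidAlgebra.map_add _)).toIntLinearMap :=
  MonoidAlgebra.map_injective _ Int.cast_injective

/-- `ℤ[X] → ℚ[X]` is `G`-equivariant for the permutation representations.
[cite: SerreLinearRepresentations1977, §15.1 (lattices)] -/
theorem intCastMonoidAlgebra_equivariant (s : G) (f : MonoidAlgebra ℤ X) :
    (AddMonoidHom.mk' (MonoidAlgebra.map (M := X) (Int.castAddHom ℚ))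
        (MonoidAlgebra.map_add _)).toIntLinearMap (ofMulAction ℤ G X s f) =
      ofMulAction ℚ G X s ((AddMonoidHom.mk' (MonoidAlgebra.map (M := X) (Int.castAddHom ℚ))
        (MonoidAlgebra.map_add _)).toIntLinearMap f) := by
  induction f using MonoidAlgebra.induction_linear with
  | zero => simp only [map_zero]
  | add f g hf hg => simp only [map_add, hf, hg]
  | single x n =>
    simp only [AddMonoidHom.coe_toIntLinearMap, AddMonoidHom.mk'_apply, ofMulAction_single,
      MonoidAlgebra.map_single]

/-- The `ℚ`-span of `ℤ[X]` in `ℚ[X]` is everything. [cite: SerreLinearRepresentations1977, §15.1 (lattices)] -/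
theorem span_range_intCastMonoidAlgebra :
    span ℚ (Set.range (AddMonoidHom.mk' (MonoidAlgebra.map (M := X) (Int.castAddHom ℚ))
      (MonoidAlgebra.map_add _)).toIntLinearMap) = ⊤ := by
  rw [eq_top_iff, ← (MonoidAlgebra.basis X ℚ).span_eq, span_le]
  rintro _ ⟨x, rfl⟩
  refine subset_span ⟨MonoidAlgebra.single x 1, ?_⟩
  simp only [AddMonoidHom.coe_toIntLinearMap, AddMonoidHom.mk'_apply, MonoidAlgebra.map_single,
    MonoidAlgebra.basis_apply, Int.coe_castAddHom, Int.cast_one]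

end Generic

section Herbrand

variable {K : Type} [Field K] [NumberField K] {S : Set (HeightOneSpectrum (𝓞 K))}
  {F E : Type} [Field F] [Field E] [NumberField E]
  [Algebra K F] [Algebra K E] [Algebra F E] [IsScalarTower K F E]

omit [NumberField E] in
/-- The integral structure `Λ × ℤ → (ℚ ⊗ Λ) × ℚ`, `(λ, n) ↦ (1 ⊗ λ, n)` (plumbing).
[cite: CasselsFrohlichANT1967, Ch. VII §8.3 (the lattice `M = λ(L_T) + ℤg`)] -/
theorem ratStructure_apply (x : Additive (sUnits K S E) × ℤ) :
    ((TensorProduct.mk ℤ ℚ (Additive (sUnits K S E)) 1).toAddMonoidHom.prodMap (Int.castAddHom ℚ)) x =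
      ((1 : ℚ) ⊗ₜ x.1, (x.2 : ℚ)) := rfl

omit [NumberField E] in
/-- The kernel of `(λ, n) ↦ (1 ⊗ λ, n)` consists of torsion elements `(λ, 0)`.
[cite: CasselsFrohlichANT1967, Ch. VII §8.3 ("the kernel of `λ` is finite")] -/
theorem torsion_of_ratStructure_eq_zero {x : Additive (sUnits K S E) × ℤ}
    (hx : ((TensorProduct.mk ℤ ℚ (Additive (sUnits K S E)) 1).toAddMonoidHom.prodMap
      (Int.castAddHom ℚ)) x = 0) :
    (∃ n : ℤ, n ≠ 0 ∧ n • x.1 = 0) ∧ x.2 = 0 := by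
  rw [ratStructure_apply, Prod.mk_eq_zero] at hx
  refine ⟨?_, by exact_mod_cast hx.2⟩
  obtain ⟨⟨s, hs⟩, hsx⟩ := (IsLocalizedModule.eq_zero_iff (nonZeroDivisors ℤ)
    (TensorProduct.mk ℤ ℚ (Additive (sUnits K S E)) 1)).1 hx.1
  exact ⟨s, nonZeroDivisors.ne_zero hs, hsx⟩

omit [NumberField E] in
/-- **A submodule of `Λ × ℤ` (`Λ = 𝒪_{E,S}^×` additively) consisting of torsion elements `(λ, 0)`
is finite cyclic** when finite: it embeds in `Eˣ` (a finite subgroup of the units of a field is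
cyclic). [cite: CasselsFrohlichANT1967, Ch. VII §8.3] -/
theorem isAddCyclic_of_snd_eq_zero (T : Submodule ℤ (Additive (sUnits K S E) × ℤ)) [Finite T]
    (hT : ∀ x ∈ T, x.2 = 0) : IsAddCyclic T := by
  -- `T → Eˣ → E`, multiplicatively
  let g : T →+ Additive Eˣ :=
    ((sUnits K S E).subtype.toAdditive.comp (AddMonoidHom.fst _ _)).comp T.subtype.toAddMonoidHom
  let f : Multiplicative T →* E := (Units.coeHom E).comp (AddMonoidHom.toMultiplicativeLeft g)
  have hf : Injective f := by
    intro a b hab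
    have h1 : g a.toAdd = g b.toAdd := by
      apply Additive.toMul.injective
      exact Units.val_injective hab
    have h2 : ((a.toAdd : Additive (sUnits K S E) × ℤ)).1 = ((b.toAdd : Additive (sUnits K S E) × ℤ)).1 := by
      apply Additive.toMul.injective
      exact Subtype.ext (congrArg Additive.toMul h1)
    apply Multiplicative.toAdd.injective
    apply Subtype.ext
    exact Prod.ext h2 (by rw [hT _ a.toAdd.2, hT _ b.toAdd.2])
  haveI : Finite (Multiplicative T) := Finite.of_equiv T Multiplicative.ofAdd
  haveI : IsCyclic (Multiplicative T) := isCyclic_of_injective_ringHom f hf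
  exact isCyclic_multiplicative_iff.1 ‹_›

end Herbrand

/-! ## §2 The equivariant `S`-unit theorem mod `p` -/

section Main

variable {K : Type} [Field K] [NumberField K] {S : Set (HeightOneSpectrum (𝓞 K))}
  {F E : Type} [Field F] [NumberField F] [Field E] [NumberField E]
  [Algebra K F] [Algebra K E] [Algebra F E] [IsScalarTower K F E] [IsGalois F E]
  {A : Type*} [AddCommGroup A] {p : ℕ}

variable (ψ : ∀ ⦃Y : Type⦄ [AddCommGroup Y] [Module ℤ Y], Representation ℤ (E ≃ₐ[F] E) Y → A)
  (hψ : ∀ ⦃Y₁ Y Y₂ : Type⦄ [AddCommGroup Y₁] [Module ℤ Y₁] [AddCommGroup Y] [Module ℤ Y]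
    [AddCommGroup Y₂] [Module ℤ Y₂] (ρ₁ : Representation ℤ (E ≃ₐ[F] E) Y₁)
    (ρY : Representation ℤ (E ≃ₐ[F] E) Y) (ρ₂ : Representation ℤ (E ≃ₐ[F] E) Y₂)
    (f : Y₁ →ₗ[ℤ] Y) (g : Y →ₗ[ℤ] Y₂),
    (∀ s x, f (ρ₁ s x) = ρY s (f x)) → (∀ s y, g (ρY s y) = ρ₂ s (g y)) →
    Injective f → Surjective g → LinearMap.range f = LinearMap.ker g → Finite Y →
    (∀ y : Y, (p : ℤ) • y = 0) → ψ ρY = ψ ρ₁ + ψ ρ₂)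
include hψ

omit [NumberField F] [NumberField E] [IsGalois F E] in
/-- `ψ((Λ × ℤ)/p) = ψ(Λ/p) + ψ(ℤ/p)` for the product with the unit representation (the sequence
`0 → Λ/pΛ → (Λ × ℤ)/p → ℤ/p → 0` splits). [cite: SerreLinearRepresentations1977, §15.2 Thm. 32] -/
theorem additive_reduction_prod_trivial [hp : Fact p.Prime] {Λ : Type} [AddCommGroup Λ]
    (ρ : Representation ℤ (E ≃ₐ[F] E) Λ) [Finite (Λ ⧸ ((p : ℤ) • ⊤ : Submodule ℤ Λ))] :
    ψ ((ρ.prod (Representation.trivial ℤ (E ≃ₐ[F] E) ℤ)).quotient ((p : ℤ) • ⊤)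
        (smul_top_le_comap _ (p : ℤ))) =
      ψ (ρ.quotient ((p : ℤ) • ⊤) (smul_top_le_comap ρ (p : ℤ))) +
        ψ ((Representation.trivial ℤ (E ≃ₐ[F] E) ℤ).quotient ((p : ℤ) • ⊤)
          (smul_top_le_comap _ (p : ℤ))) := by
  set ρ₁ := ρ.prod (Representation.trivial ℤ (E ≃ₐ[F] E) ℤ) with hρ₁
  have hf₀ : ((p : ℤ) • ⊤ : Submodule ℤ Λ) ≤ ((p : ℤ) • ⊤ : Submodule ℤ (Λ × ℤ)).comap
      (LinearMap.inl ℤ Λ ℤ) := by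
    intro x hx
    obtain ⟨y, rfl⟩ := (Int.mem_smul_top_iff _ _).1 hx
    exact (Int.mem_smul_top_iff _ _).2 ⟨(y, 0), by simp⟩
  have hg₀ : ((p : ℤ) • ⊤ : Submodule ℤ (Λ × ℤ)) ≤ ((p : ℤ) • ⊤ : Submodule ℤ ℤ).comap
      (LinearMap.snd ℤ Λ ℤ) := by
    intro x hx
    obtain ⟨y, rfl⟩ := (Int.mem_smul_top_iff _ _).1 hx
    exact (Int.mem_smul_top_iff _ _).2 ⟨y.2, by simp⟩
  -- finiteness of `(Λ × ℤ)/p`: it is the middle of the sequence below; prove via the surjection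
  -- `Λ/p × ℤ/p → (Λ × ℤ)/p`
  haveI : Finite (ℤ ⧸ ((p : ℤ) • ⊤ : Submodule ℤ ℤ)) :=
    Int.finite_quotient_smul_top (by exact_mod_cast hp.out.ne_zero)
  haveI : Finite ((Λ × ℤ) ⧸ ((p : ℤ) • ⊤ : Submodule ℤ (Λ × ℤ))) := by
    refine Finite.of_surjective (fun q : (Λ ⧸ ((p : ℤ) • ⊤ : Submodule ℤ Λ)) ×
        (ℤ ⧸ ((p : ℤ) • ⊤ : Submodule ℤ ℤ)) =>
      mapQ _ _ (LinearMap.inl ℤ Λ ℤ) hf₀ q.1 +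
        mapQ _ _ (LinearMap.inr ℤ Λ ℤ) (fun x hx => by
          obtain ⟨y, rfl⟩ := (Int.mem_smul_top_iff _ _).1 hx
          exact (Int.mem_smul_top_iff _ _).2 ⟨(0, y), by simp⟩) q.2) fun z => ?_
    obtain ⟨⟨a, b⟩, rfl⟩ := mkQ_surjective _ z
    refine ⟨(Submodule.Quotient.mk a, Submodule.Quotient.mk b), ?_⟩
    change Submodule.Quotient.mk (LinearMap.inl ℤ Λ ℤ a) + Submodule.Quotient.mk (LinearMap.inr ℤ Λ ℤ b) = _
    rw [← Submodule.Quotient.mk_add, LinearMap.inl_apply, LinearMap.inr_apply, Prod.mk_add_mk,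
      add_zero, zero_add]
    rfl
  refine hψ (ρ.quotient _ (smul_top_le_comap ρ (p : ℤ))) (ρ₁.quotient _ (smul_top_le_comap ρ₁ (p : ℤ)))
    ((Representation.trivial ℤ (E ≃ₐ[F] E) ℤ).quotient _ (smul_top_le_comap _ (p : ℤ)))
    (mapQ _ _ (LinearMap.inl ℤ Λ ℤ) hf₀) (mapQ _ _ (LinearMap.snd ℤ Λ ℤ) hg₀)
    ?_ ?_ ?_ ?_ ?_ ‹_› (Int.smul_quotient_smul_top_eq_zero (p : ℤ))
  · intro s q
    obtain ⟨x, rfl⟩ := mkQ_surjective _ q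
    change Submodule.Quotient.mk (LinearMap.inl ℤ Λ ℤ (ρ s x)) =
      Submodule.Quotient.mk (ρ₁ s (LinearMap.inl ℤ Λ ℤ x))
    rw [LinearMap.inl_apply, LinearMap.inl_apply, hρ₁, Representation.prod_apply_apply,
      Representation.trivial_apply]
  · intro s q
    obtain ⟨x, rfl⟩ := mkQ_surjective _ q
    rfl
  · rw [← LinearMap.ker_eq_bot, eq_bot_iff]
    intro q hq
    obtain ⟨x, rfl⟩ := mkQ_surjective _ q
    rw [mkQ_apply, LinearMap.mem_ker, mapQ_apply, Submodule.Quotient.mk_eq_zero,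
      Int.mem_smul_top_iff] at hq
    obtain ⟨⟨y, n⟩, hy⟩ := hq
    rw [mem_bot, mkQ_apply, Submodule.Quotient.mk_eq_zero, Int.mem_smul_top_iff]
    exact ⟨y, by simpa using congrArg Prod.fst hy⟩
  · intro z
    obtain ⟨n, rfl⟩ := mkQ_surjective _ z
    exact ⟨Submodule.Quotient.mk ((0 : Λ), n), rfl⟩
  · apply le_antisymm
    · rintro _ ⟨q, rfl⟩
      obtain ⟨x, rfl⟩ := mkQ_surjective _ q
      rw [LinearMap.mem_ker, mkQ_apply, mapQ_apply, mapQ_apply, LinearMap.snd_apply,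
        LinearMap.inl_apply]
      rfl
    · intro q hq
      obtain ⟨⟨a, n⟩, rfl⟩ := mkQ_surjective _ q
      rw [LinearMap.mem_ker, mkQ_apply, mapQ_apply, LinearMap.snd_apply,
        Submodule.Quotient.mk_eq_zero, Int.mem_smul_top_iff] at hq
      obtain ⟨m, hm⟩ := hq
      refine ⟨Submodule.Quotient.mk a, ?_⟩
      rw [mapQ_apply, mkQ_apply, LinearMap.inl_apply, Submodule.Quotient.eq, Int.mem_smul_top_iff]
      exact ⟨((0 : Λ), -m), by rw [Prod.smul_mk, smul_zero, smul_neg, hm]; simp⟩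

omit [NumberField F] [NumberField E] [IsGalois F E] in
/-- `(Λ × ℤ)[p] ≅ Λ[p]` for the product with the (torsion-free) unit representation.
[cite: SerreLinearRepresentations1977, §15.2 Thm. 32] -/
theorem additive_torsionBy_prod_trivial [hp : Fact p.Prime] {Λ : Type} [AddCommGroup Λ]
    (ρ : Representation ℤ (E ≃ₐ[F] E) Λ) [Finite (torsionBy ℤ Λ (p : ℤ))] :
    ψ ((ρ.prod (Representation.trivial ℤ (E ≃ₐ[F] E) ℤ)).subrepresentation
        (torsionBy ℤ (Λ × ℤ) (p : ℤ)) (torsionBy_le_comap _ (p : ℤ))) =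
      ψ (ρ.subrepresentation (torsionBy ℤ Λ (p : ℤ)) (torsionBy_le_comap ρ (p : ℤ))) := by
  obtain ⟨good_sub, good_quot, hψ'⟩ := Int.admissible ψ hψ
  have hsnd : ∀ x : torsionBy ℤ (Λ × ℤ) (p : ℤ), (x : Λ × ℤ).2 = 0 := fun x => by
    have hx := congrArg Prod.snd ((mem_torsionBy_iff _ _).1 x.2)
    rw [Prod.smul_snd, Prod.snd_zero, smul_eq_mul, mul_eq_zero] at hx
    exact hx.resolve_left (by exact_mod_cast hp.out.ne_zero)
  have hfst : ∀ x : torsionBy ℤ (Λ × ℤ) (p : ℤ), (x : Λ × ℤ).1 ∈ torsionBy ℤ Λ (p : ℤ) := fun x => by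
    have hx := congrArg Prod.fst ((mem_torsionBy_iff _ _).1 x.2)
    rw [Prod.smul_fst, Prod.fst_zero] at hx
    exact (mem_torsionBy_iff _ _).2 hx
  let f : torsionBy ℤ (Λ × ℤ) (p : ℤ) →ₗ[ℤ] torsionBy ℤ Λ (p : ℤ) :=
    LinearMap.codRestrict _ (LinearMap.fst ℤ Λ ℤ ∘ₗ (torsionBy ℤ (Λ × ℤ) (p : ℤ)).subtype) hfst
  have hfbij : Function.Bijective f := by
    constructor
    · intro a b hab
      have h1 : (a : Λ × ℤ).1 = (b : Λ × ℤ).1 := congrArg (fun y : torsionBy ℤ Λ (p : ℤ) => (y : Λ)) hab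
      exact Subtype.ext (Prod.ext h1 (by rw [hsnd, hsnd]))
    · intro y
      refine ⟨⟨((y : Λ), 0), (mem_torsionBy_iff _ _).2 ?_⟩, Subtype.ext rfl⟩
      rw [Prod.smul_mk, smul_zero, (mem_torsionBy_iff _ _).1 y.2]
      rfl
  refine Admissible.additive_eq_of_linearEquiv ψ _ good_quot hψ' _ _
    ⟨‹_›, fun y => Subtype.ext (by
      rw [Submodule.coe_smul, Submodule.coe_zero]; exact (mem_torsionBy_iff _ _).1 y.2)⟩
    (LinearEquiv.ofBijective f hfbij) (fun s x => ?_)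
  apply Subtype.ext
  change ((ρ.prod (Representation.trivial ℤ (E ≃ₐ[F] E) ℤ)) s (x : Λ × ℤ)).1 = ρ s ((x : Λ × ℤ).1)
  rw [Representation.prod_apply_apply]

/-- **The equivariant `S`-unit theorem mod `p` (Herbrand + Serre Thm. 32):
`[𝒪_{E,S}^×/p] + [𝔽_p] = [𝒪_{E,S}^×[p]] + [𝔽_p[S_E ⊔ S_∞(E)]]`** — for number fields
`K ⊆ F ⊆ E` with `E/F` Galois, `S` a finite set of finite places of `K`, `p` a prime and EVERY
function `ψ` on `ℤ[Gal(E/F)]`-modules additive on short exact sequences of finite `p`-torsion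
modules: `ψ(Λ/pΛ) + ψ(ℤ/p) = ψ(Λ[p]) + ψ(ℤ[X]/p)`, `Λ = sUnitsRepρ K S F E` (`𝒪_{E,S}^×`),
`X = placesAbove K S F E ⊕ InfinitePlace E`, `ℤ[X] = Representation.ofMulAction ℤ _ X`,
`Λ[p]` the `p`-th roots of unity of `E` with their Galois action.  Proof: Herbrand's rational
isomorphism (`EquivariantSUnitRank`) compared with `ℤ[X] ⊂ ℚ[X]` via
`additive_reduction_eq_torsionBy_add_of_span_eq_top` (the torsion of `𝒪_{E,S}^×` is cyclic).
[cite: NeukirchSchmidtWingberg2008, (8.7.2)] [cite: CasselsFrohlichANT1967, Ch. VII §8.3]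
[cite: MilneADT2006, I Lemma 2.12 / §5 (proof of Thm. 5.1)] [cite: SerreLinearRepresentations1977, §15.2 Thm. 32] -/
theorem additive_sUnits_reduction [hp : Fact p.Prime] (hS : S.Finite) :
    ψ ((sUnitsRepρ K S F E).quotient ((p : ℤ) • ⊤) (smul_top_le_comap _ (p : ℤ))) +
      ψ ((Representation.trivial ℤ (E ≃ₐ[F] E) ℤ).quotient ((p : ℤ) • ⊤)
          (smul_top_le_comap _ (p : ℤ))) =
    ψ ((sUnitsRepρ K S F E).subrepresentation (torsionBy ℤ (Additive (sUnits K S E)) (p : ℤ))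
        (torsionBy_le_comap _ (p : ℤ))) +
      ψ ((Representation.ofMulAction ℤ (E ≃ₐ[F] E) (placesAbove K S F E ⊕ InfinitePlace E)).quotient
          ((p : ℤ) • ⊤) (smul_top_le_comap _ (p : ℤ))) := by
  classical
  -- finiteness bookkeeping
  haveI : Finite (placesAbove K S F E) := finite_placesAbove hS
  haveI : Finite {w : HeightOneSpectrum (𝓞 E) | w.under (𝓞 K) ∈ S} :=
    (finite_setOf_under_mem K E hS).to_subtype
  haveI hΛfin : Module.Finite ℤ (Additive (sUnits K S E)) := by
    rw [sUnits_eq_unit_setOf_under_mem (K := K) (S := S) (E := E)]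
    infer_instance
  haveI : Module.Finite ℤ (MonoidAlgebra ℤ (placesAbove K S F E ⊕ InfinitePlace E)) :=
    Module.Finite.of_basis (MonoidAlgebra.basis _ ℤ)
  -- notation
  let G := E ≃ₐ[F] E
  let Λ := Additive (sUnits K S E)
  let X := placesAbove K S F E ⊕ InfinitePlace E
  let ρ : Representation ℤ G Λ := sUnitsRepρ K S F E
  let ρ₁ : Representation ℤ G (Λ × ℤ) := ρ.prod (Representation.trivial ℤ G ℤ)
  let ρ₂ : Representation ℤ G (MonoidAlgebra ℤ X) := Representation.ofMulAction ℤ G X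
  let τ : Representation ℚ G (MonoidAlgebra ℚ X) := Representation.ofMulAction ℚ G X
  -- Herbrand's rational isomorphism
  obtain ⟨eH⟩ := nonempty_equiv_sUnitsRep_baseChange_prod_trivial_ofMulAction
    (K := K) (S := S) (F := F) (E := E) hS
  let j₀ : Λ × ℤ →+ (ℚ ⊗[ℤ] Λ) × ℚ :=
    (TensorProduct.mk ℤ ℚ Λ 1).toAddMonoidHom.prodMap (Int.castAddHom ℚ)
  let i₁ : Λ × ℤ →ₗ[ℤ] MonoidAlgebra ℚ X :=
    (eH.toLinearEquiv.toAddMonoidHom.comp j₀).toIntLinearMap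
  let i₂ : MonoidAlgebra ℤ X →ₗ[ℤ] MonoidAlgebra ℚ X :=
    (AddMonoidHom.mk' (MonoidAlgebra.map (M := X) (Int.castAddHom ℚ))
      (MonoidAlgebra.map_add _)).toIntLinearMap
  have hi₁ : ∀ x, i₁ x = eH.toLinearEquiv (j₀ x) := fun x => rfl
  -- equivariance of the rational structure
  have hj₀ : ∀ (s : G) (x : Λ × ℤ), j₀ (ρ₁ s x) =
      ((repBaseChange ℚ ρ).prod (Representation.trivial ℚ G ℚ)) s (j₀ x) := fun s x => by
    rw [ratStructure_apply, ratStructure_apply, Representation.prod_apply_apply,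
      Representation.prod_apply_apply, Representation.trivial_apply, Representation.trivial_apply,
      repBaseChange_apply, LinearMap.baseChange_tmul]
  have h₁ : ∀ (s : G) (x : Λ × ℤ), i₁ (ρ₁ s x) = τ s (i₁ x) := fun s x => by
    rw [hi₁, hi₁, hj₀]
    exact LinearMap.congr_fun (eH.isIntertwining' s) (j₀ x)
  -- spanning
  have ht : ∀ t : ℚ ⊗[ℤ] Λ, ((t, (0 : ℚ)) : (ℚ ⊗[ℤ] Λ) × ℚ) ∈ span ℚ (Set.range j₀) := by
    intro t
    induction t using TensorProduct.induction_on with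
    | zero => exact zero_mem _
    | tmul a l =>
      have : ((a ⊗ₜ[ℤ] l, (0 : ℚ)) : (ℚ ⊗[ℤ] Λ) × ℚ) = a • (((1 : ℚ) ⊗ₜ[ℤ] l), (0 : ℚ)) := by
        rw [Prod.smul_mk, smul_zero, TensorProduct.smul_tmul', smul_eq_mul, mul_one]
      rw [this]
      exact smul_mem _ a (subset_span ⟨(l, 0), by rw [ratStructure_apply, Int.cast_zero]⟩)
    | add t₁ t₂ h₁' h₂' =>
      have : ((t₁ + t₂, (0 : ℚ)) : (ℚ ⊗[ℤ] Λ) × ℚ) = (t₁, 0) + (t₂, 0) := by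
        rw [Prod.mk_add_mk, add_zero]
      rw [this]
      exact add_mem h₁' h₂'
  have hsp₀ : span ℚ (Set.range j₀) = ⊤ := by
    rw [eq_top_iff]
    rintro ⟨t, q⟩ -
    have hsplit : ((t, q) : (ℚ ⊗[ℤ] Λ) × ℚ) = (t, 0) + q • ((0 : ℚ ⊗[ℤ] Λ), (1 : ℚ)) := by
      rw [Prod.smul_mk, smul_zero, smul_eq_mul, mul_one, Prod.mk_add_mk, add_zero, zero_add]
    rw [hsplit]
    exact add_mem (ht t) (smul_mem _ q (subset_span ⟨((0 : Λ), (1 : ℤ)), by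
      rw [ratStructure_apply, TensorProduct.tmul_zero, Int.cast_one]⟩))
  have hsp₁ : span ℚ (Set.range i₁) = ⊤ := by
    have hrange : Set.range i₁ = eH.toLinearEquiv '' Set.range j₀ := by
      ext v
      simp only [Set.mem_range, Set.mem_image, hi₁]
      constructor
      · rintro ⟨x, rfl⟩; exact ⟨j₀ x, ⟨x, rfl⟩, rfl⟩
      · rintro ⟨_, ⟨x, rfl⟩, rfl⟩; exact ⟨x, rfl⟩
    rw [hrange, span_image_linearEquiv, hsp₀, Submodule.map_top, LinearMap.range_eq_top]
    exact eH.toLinearEquiv.surjective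
  -- the kernel of `i₁`: torsion elements `(λ, 0)`; finite and cyclic
  have hker : ∀ x ∈ LinearMap.ker i₁, (∃ n : ℤ, n ≠ 0 ∧ n • x.1 = 0) ∧ x.2 = 0 := fun x hx => by
    rw [LinearMap.mem_ker, hi₁, LinearEquiv.map_eq_zero_iff] at hx
    exact torsion_of_ratStructure_eq_zero hx
  haveI : Module.Finite ℤ (Λ × ℤ) := inferInstance
  haveI : Finite (LinearMap.ker i₁) := by
    haveI : Module.Finite ℤ (LinearMap.ker i₁) := inferInstance
    refine Module.finite_of_fg_torsion _ fun x => ?_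
    obtain ⟨⟨n, hn, hnx⟩, hx2⟩ := hker x.1 x.2
    refine ⟨⟨n, mem_nonZeroDivisors_of_ne_zero hn⟩, Subtype.ext ?_⟩
    rw [Submonoid.mk_smul, Submodule.coe_smul, Submodule.coe_zero, Prod.ext_iff, Prod.smul_fst,
      Prod.smul_snd, hnx, hx2, smul_zero]
    exact ⟨rfl, rfl⟩
  haveI : IsAddCyclic (LinearMap.ker i₁) :=
    isAddCyclic_of_snd_eq_zero (LinearMap.ker i₁) (fun x hx => (hker x hx).2)
  -- the generic comparison
  have key := Int.additive_reduction_eq_torsionBy_add_of_span_eq_top ψ hψ τ ρ₁ ρ₂ i₁ i₂ h₁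
    (intCastMonoidAlgebra_equivariant (G := G) (X := X)) intCastMonoidAlgebra_injective hsp₁
    span_range_intCastMonoidAlgebra
  -- `(Λ × ℤ)/p = Λ/p + ℤ/p` and `(Λ × ℤ)[p] = Λ[p]`
  haveI : Finite (Λ ⧸ ((p : ℤ) • ⊤ : Submodule ℤ Λ)) :=
    Int.finite_quotient_smul_top (by exact_mod_cast hp.out.ne_zero)
  haveI : Finite (torsionBy ℤ Λ (p : ℤ)) := by
    haveI : Module.Finite ℤ (torsionBy ℤ Λ (p : ℤ)) := inferInstance
    refine Module.finite_of_fg_torsion _ fun x =>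
      ⟨⟨(p : ℤ), mem_nonZeroDivisors_of_ne_zero (by exact_mod_cast hp.out.ne_zero)⟩, Subtype.ext ?_⟩
    rw [Submonoid.mk_smul, Submodule.coe_smul, Submodule.coe_zero]
    exact (mem_torsionBy_iff _ _).1 x.2
  rw [additive_reduction_prod_trivial ψ hψ ρ, additive_torsionBy_prod_trivial ψ hψ ρ] at key
  exact key

end Main

end EquivariantSUnit

end Literature.NumberTheory.NumberFields

end
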